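import Summits.Ventures.YMGap.RobustBall.MassGapOnBall
import HarnessLib

/-!
# Venture YMGap, track Y2 ROBUST-BALL — `SU(3)` rows of the `ℤ^d` single-link ball theorem ON THE CELL'S CERTIFIED
# ONE-LINK PAIR (engine-2 lineage): `MassGapOnBallZd d 3 (β_W/9) ε₀ ε₁ R`

HONEST FRAMING.  Venture file of the cell `pub-ymgap` (QuantumFields programme), seat engine-2 (g5).  Strong-coupling LATTICE
statements only (`SU(3)` lattice Yang–Mills on `ℤ^d` plus a link perturbation in the tier-1 ball; Wilson coupling `β_W`, tree
coupling `β_W/3`, 't Hooft `β_W/9`); nothing about the continuum, weak coupling, or the Clay problem.  Kernel ARITHMETIC over two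
tree theorems, nothing else: rb-p1's tier-1 `ℤ^d` ball theorem with the one-link pair left symbolic
(`RobustBall.massGapOnBallZd_of_pair`: `b ≥ 2(d−1)|β|`, `6(d−1)|β| e^{ε₀} √(c v) + e^{ε₀/2} √c ε₁ < 1` ⇒ `MassGapOnBallZd d N β ε₀ ε₁ R`)
fed with the cell's CERTIFIED `SU(3)` pair — the same two displayed finite-dimensional hypotheses as every `SU(3)` row of record
(R137/R144): H1 `OneLinkPoincareSUN 3 (3/5) (4/5)` (cell `pub-ymgap`, σ2 engines A + B on partition P1 and A on P2; class
«C(A@P1+B@P1+A@P2)») restricted by monotonicity to radius `11/30`, and H2 `OneLinkVarianceBound 3 (11/30) (49/20)` (`pub-balaban` g17 +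
`pub-ymgap` replay; class C-iv), whose Poincaré × variance modulus is `√((4/5)(49/20)) = 7/5` EXACTLY and whose Holley–Stroock transfer
factor is `e^{ε₀}` (no self-Lipschitz factor; `Thresholds/TiltOscillationVariance`, `RobustBall/RobustOneLink`).  NOTHING is asserted about
H1/H2 here: every row below is K-conditional on them, displayed.

THE ROWS (one-parameter convention of the design / referee lineage R: `ε₀ = 2ε`, `ε₁ = ε`; `d = 4`, 't Hooft `β = β_W/9`, radius
`2(d−1)|β| = (2/3)|β_W| ≤ 11/30 ⇔ |β_W| ≤ 11/20`; row sum `ρ = (14/5)|β_W| e^{2ε} + e^{ε} √(4/5) ε < 1`, certified in exact rational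
arithmetic with `e^x ≤ 1 + x + x²/2 + x³/6 + (5/96)x⁴` (`Real.exp_bound'`, `0 ≤ x ≤ 1`) and `√(4/5) ≤ 0.8945`):
`(β⋆_W, ε) = (1/10, .347) (1/8, .299) (1/6, .230) (5/28, .212) (1/5, .181) (1/4, .116) (3/10, .058) (1/3, .023)`;
the Wilson threshold of this door on this pair is `β_W = 5/14 = 0.357` (`(14/5)β_W < 1`; hypothesis-free all-`N` Bakry–Émery: `9/48 = 0.1875`).
These are the `SU(3)` single-link/`ℤ^4` entries of engine-2's ROBUST-ONELINK-TABLE.md §B1 (same numbers, there labelled arithmetic; here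
kernel rows GIVEN H1/H2 and rb-p1's door).  Not the star door (crux Y2-X2), not the slab/area-law door (rb-p2).
-/

noncomputable section

open MeasureTheory ProbabilityTheory Real
open Literature.MathematicalPhysics.QuantumFieldTheory
open Summit.QuantumFields.BalabanUV.InfraRed.StrongCouplingPoincareDoorSUN (OneLinkPoincareSUN OneLinkPoincareSUN.mono)
open Summit.QuantumFields.BalabanUV.InfraRed.StrongCouplingVarianceDoorSUN (OneLinkVarianceBound)
open Summit.Ventures.YMGap.RobustBall (MassGapOnBallZd massGapOnBallZd_of_pair)

namespace Summit.Ventures.YMGap.RobustBallSU3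

variable {d : ℕ}

/-! ### 1. The `SU(3)` ball theorem on a symbolic pair at the radius of the certificates, every dimension -/

/-- **`SU(3)`, every `d ≥ 1`: the `ℤ^d` single-link ball theorem on a one-link pair at radius `11/30`** (Wilson units).  GIVEN
`OneLinkPoincareSUN 3 (11/30) c` and `OneLinkVarianceBound 3 (11/30) v` (`0 ≤ c, v`), every `β_W` with `2(d−1)|β_W|/9 ≤ 11/30` and every
`(ε₀, ε₁, R)` with `6(d−1)(|β_W|/9)·e^{ε₀}√(c v) + e^{ε₀/2}√c·ε₁ < 1` give `MassGapOnBallZd d 3 (β_W/9) ε₀ ε₁ R` — rb-p1's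
`massGapOnBallZd_of_pair` with the schemas passed by name. [folklore] -/
theorem su3_massGapOnBallZd_of_pair (hd : 1 ≤ d) {c v βW ε₀ ε₁ : ℝ} (R : ℝ) (hc : 0 ≤ c) (hv : 0 ≤ v)
    (hP : OneLinkPoincareSUN 3 (11 / 30) c) (hV : OneLinkVarianceBound 3 (11 / 30) v)
    (hb : |βW / 9| * (2 * ((d : ℝ) - 1)) ≤ 11 / 30)
    (hρ : 6 * ((d : ℝ) - 1) * |βW / 9| * (exp ε₀ * Real.sqrt (c * v)) + exp (ε₀ / 2) * Real.sqrt c * ε₁ < 1) :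
    MassGapOnBallZd d 3 (βW / 9) ε₀ ε₁ R :=
  massGapOnBallZd_of_pair d 3 hd (by norm_num) R hc hv le_rfl (fun B hB => hP B (hB.trans hb)) (fun B hB => hV B (hB.trans hb)) hρ

/-- **`SU(3)`, every `d ≥ 1`, ON THE CELL'S CERTIFICATES H1, H2**: `√(c v) = 7/5`, `√c = √(4/5)`; every `β_W` with `(d−1)|β_W| ≤ 33/20` and
every `(ε₀, ε₁, R)` with `(14/15)(d−1)|β_W| e^{ε₀} + e^{ε₀/2} √(4/5) ε₁ < 1` give `MassGapOnBallZd d 3 (β_W/9) ε₀ ε₁ R`. [folklore] -/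
theorem su3_massGapOnBallZd_of_certificates (hd : 1 ≤ d) {βW ε₀ ε₁ : ℝ} (R : ℝ) (hP : OneLinkPoincareSUN 3 (3 / 5) (4 / 5))
    (hV : OneLinkVarianceBound 3 (11 / 30) (49 / 20)) (hR : ((d : ℝ) - 1) * |βW| ≤ 33 / 20)
    (hρ : 14 / 15 * (((d : ℝ) - 1) * |βW|) * exp ε₀ + exp (ε₀ / 2) * Real.sqrt (4 / 5) * ε₁ < 1) :
    MassGapOnBallZd d 3 (βW / 9) ε₀ ε₁ R := by
  have hP' : OneLinkPoincareSUN 3 (11 / 30) (4 / 5) := hP.mono (by norm_num) le_rfl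
  have hsq : Real.sqrt (4 / 5 * (49 / 20)) = 7 / 5 := by
    rw [show (4 / 5 * (49 / 20) : ℝ) = (7 / 5) ^ 2 by norm_num, Real.sqrt_sq (by norm_num)]
  have h9 : |βW / 9| = |βW| / 9 := by rw [abs_div, abs_of_pos (by norm_num : (0 : ℝ) < 9)]
  have hd1 : (0 : ℝ) ≤ (d : ℝ) - 1 := by
    have : (1 : ℝ) ≤ d := by exact_mod_cast hd
    linarith
  refine su3_massGapOnBallZd_of_pair hd R (by norm_num) (by norm_num) hP' hV ?_ ?_
  · rw [h9]
    nlinarith [abs_nonneg βW]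
  · rw [hsq, h9]
    have e : 6 * ((d : ℝ) - 1) * (|βW| / 9) * (exp ε₀ * (7 / 5)) = 14 / 15 * (((d : ℝ) - 1) * |βW|) * exp ε₀ := by ring
    rw [e]
    exact hρ

/-! ### 2. `d = 4`: the one-parameter rows `(ε₀, ε₁) = (2ε, ε)` with exact rational certificates -/

/-- `e^x ≤ 1 + x + x²/2 + x³/6 + (5/96)x⁴` on `[0, 1]` (Mathlib's `Real.exp_bound'` at `n = 4`). [folklore] -/
theorem exp_le_taylor4 {x : ℝ} (h0 : 0 ≤ x) (h1 : x ≤ 1) :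
    exp x ≤ 1 + x + x ^ 2 / 2 + x ^ 3 / 6 + 5 / 96 * x ^ 4 := by
  have h := Real.exp_bound' h0 h1 (n := 4) (by norm_num)
  have hs : ∑ m ∈ Finset.range 4, x ^ m / (m.factorial : ℝ) = 1 + x + x ^ 2 / 2 + x ^ 3 / 6 := by
    simp only [Finset.sum_range_succ, Finset.sum_range_zero, Nat.factorial, Nat.succ_eq_add_one]
    norm_num
  rw [hs] at h
  have h4 : x ^ 4 * ((4 : ℕ) + 1 : ℝ) / ((Nat.factorial 4 : ℕ) * (4 : ℕ) : ℝ) = 5 / 96 * x ^ 4 := by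
    norm_num [Nat.factorial]
    ring
  linarith [h4.symm.le, h4.le]

/-- `√(4/5) ≤ 0.8945`. [folklore] -/
theorem sqrt_four_fifths_le : Real.sqrt (4 / 5) ≤ 0.8945 := by
  rw [show (0.8945 : ℝ) = Real.sqrt (0.8945 ^ 2) by rw [Real.sqrt_sq (by norm_num)]]
  exact Real.sqrt_le_sqrt (by norm_num)

/-- **`SU(3)`, `d = 4`, one-parameter row schema**: for `0 ≤ β_W ≤ 11/20`, `0 ≤ ε ≤ 1/2` and the RATIONAL certificate
`(14/5)β_W·T(2ε) + T(ε)·0.8945·ε < 1`, `T(x) = 1 + x + x²/2 + x³/6 + (5/96)x⁴`, the ball row `MassGapOnBallZd 4 3 (β_W/9) (2ε) ε R` holds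
for every range `R`, GIVEN H1, H2. [folklore] -/
theorem su3_row (R : ℝ) (hP : OneLinkPoincareSUN 3 (3 / 5) (4 / 5)) (hV : OneLinkVarianceBound 3 (11 / 30) (49 / 20))
    {βW ε : ℝ} (hβ0 : 0 ≤ βW) (hβ : βW ≤ 11 / 20) (hε0 : 0 ≤ ε) (hε1 : ε ≤ 1 / 2)
    (hcert : 14 / 5 * βW * (1 + 2 * ε + (2 * ε) ^ 2 / 2 + (2 * ε) ^ 3 / 6 + 5 / 96 * (2 * ε) ^ 4) +
      (1 + ε + ε ^ 2 / 2 + ε ^ 3 / 6 + 5 / 96 * ε ^ 4) * 0.8945 * ε < 1) :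
    MassGapOnBallZd 4 3 (βW / 9) (2 * ε) ε R := by
  refine su3_massGapOnBallZd_of_certificates (by norm_num) R hP hV ?_ ?_
  · rw [abs_of_nonneg hβ0]; push_cast; linarith
  · rw [abs_of_nonneg hβ0]
    have hT2 := exp_le_taylor4 (x := 2 * ε) (by linarith) (by linarith)
    have hT1 := exp_le_taylor4 (x := ε) hε0 (by linarith)
    have e2 : (2 * ε) / 2 = ε := by ring
    rw [e2]
    have hs := sqrt_four_fifths_le
    have hA : 14 / 15 * ((((4 : ℕ) : ℝ) - 1) * βW) * exp (2 * ε) ≤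
        14 / 5 * βW * (1 + 2 * ε + (2 * ε) ^ 2 / 2 + (2 * ε) ^ 3 / 6 + 5 / 96 * (2 * ε) ^ 4) := by
      have e : 14 / 15 * ((((4 : ℕ) : ℝ) - 1) * βW) = 14 / 5 * βW := by push_cast; ring
      rw [e]
      exact mul_le_mul_of_nonneg_left hT2 (by positivity)
    have hB : exp ε * Real.sqrt (4 / 5) * ε ≤ (1 + ε + ε ^ 2 / 2 + ε ^ 3 / 6 + 5 / 96 * ε ^ 4) * 0.8945 * ε :=
      mul_le_mul_of_nonneg_right (mul_le_mul hT1 hs (Real.sqrt_nonneg _) (by positivity)) hε0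
    linarith

/-! ### 3. The rows of record (`d = 4`; `(β⋆_W, ε)`; class «K × C(H1) × C-iv(H2)» pending rb-ref's lineage check) -/

/-- Row `(β⋆_W, ε) = (1/10, 0.347)`: `MassGapOnBallZd 4 3 ((1/10)/9) 0.694 0.347 R` on H1, H2. [folklore] -/
theorem su3_row_1_10 (R : ℝ) (hP : OneLinkPoincareSUN 3 (3 / 5) (4 / 5)) (hV : OneLinkVarianceBound 3 (11 / 30) (49 / 20)) :
    MassGapOnBallZd 4 3 ((1 / 10 : ℝ) / 9) (2 * (347 / 1000)) (347 / 1000) R :=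
  su3_row R hP hV (by norm_num) (by norm_num) (by norm_num) (by norm_num) (by norm_num)

/-- Row `(1/8, 0.299)`. [folklore] -/
theorem su3_row_1_8 (R : ℝ) (hP : OneLinkPoincareSUN 3 (3 / 5) (4 / 5)) (hV : OneLinkVarianceBound 3 (11 / 30) (49 / 20)) :
    MassGapOnBallZd 4 3 ((1 / 8 : ℝ) / 9) (2 * (299 / 1000)) (299 / 1000) R :=
  su3_row R hP hV (by norm_num) (by norm_num) (by norm_num) (by norm_num) (by norm_num)

/-- Row `(1/6, 0.230)`. [folklore] -/
theorem su3_row_1_6 (R : ℝ) (hP : OneLinkPoincareSUN 3 (3 / 5) (4 / 5)) (hV : OneLinkVarianceBound 3 (11 / 30) (49 / 20)) :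
    MassGapOnBallZd 4 3 ((1 / 6 : ℝ) / 9) (2 * (23 / 100)) (23 / 100) R :=
  su3_row R hP hV (by norm_num) (by norm_num) (by norm_num) (by norm_num) (by norm_num)

/-- Row `(5/28, 0.212)` — HALF the Wilson threshold `5/14` of this door on this pair (design D7 headline convention (i)). [folklore] -/
theorem su3_row_5_28 (R : ℝ) (hP : OneLinkPoincareSUN 3 (3 / 5) (4 / 5)) (hV : OneLinkVarianceBound 3 (11 / 30) (49 / 20)) :
    MassGapOnBallZd 4 3 ((5 / 28 : ℝ) / 9) (2 * (53 / 250)) (53 / 250) R :=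
  su3_row R hP hV (by norm_num) (by norm_num) (by norm_num) (by norm_num) (by norm_num)

/-- Row `(1/5, 0.181)`. [folklore] -/
theorem su3_row_1_5 (R : ℝ) (hP : OneLinkPoincareSUN 3 (3 / 5) (4 / 5)) (hV : OneLinkVarianceBound 3 (11 / 30) (49 / 20)) :
    MassGapOnBallZd 4 3 ((1 / 5 : ℝ) / 9) (2 * (181 / 1000)) (181 / 1000) R :=
  su3_row R hP hV (by norm_num) (by norm_num) (by norm_num) (by norm_num) (by norm_num)

/-- Row `(1/4, 0.116)`. [folklore] -/
theorem su3_row_1_4 (R : ℝ) (hP : OneLinkPoincareSUN 3 (3 / 5) (4 / 5)) (hV : OneLinkVarianceBound 3 (11 / 30) (49 / 20)) :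
    MassGapOnBallZd 4 3 ((1 / 4 : ℝ) / 9) (2 * (29 / 250)) (29 / 250) R :=
  su3_row R hP hV (by norm_num) (by norm_num) (by norm_num) (by norm_num) (by norm_num)

/-- Row `(3/10, 0.058)` — the largest grid coupling with `ε ≥ 1/20` (design D7 headline convention (ii)). [folklore] -/
theorem su3_row_3_10 (R : ℝ) (hP : OneLinkPoincareSUN 3 (3 / 5) (4 / 5)) (hV : OneLinkVarianceBound 3 (11 / 30) (49 / 20)) :
    MassGapOnBallZd 4 3 ((3 / 10 : ℝ) / 9) (2 * (29 / 500)) (29 / 500) R :=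
  su3_row R hP hV (by norm_num) (by norm_num) (by norm_num) (by norm_num) (by norm_num)

/-- Row `(1/3, 0.023)`. [folklore] -/
theorem su3_row_1_3 (R : ℝ) (hP : OneLinkPoincareSUN 3 (3 / 5) (4 / 5)) (hV : OneLinkVarianceBound 3 (11 / 30) (49 / 20)) :
    MassGapOnBallZd 4 3 ((1 / 3 : ℝ) / 9) (2 * (23 / 1000)) (23 / 1000) R :=
  su3_row R hP hV (by norm_num) (by norm_num) (by norm_num) (by norm_num) (by norm_num)

/-- At `ε = 0` the door is the Wilson single-link door on this pair: every `0 ≤ β_W < 5/14` gives `MassGapOnBallZd 4 3 (β_W/9) 0 0 R`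
(hence the cell's `MassGapAt 4 3 (β_W/9)` by `MassGapOnBallZd.massGapAt`; the STAR door's `11/20` is not reproduced by this door). [folklore] -/
theorem su3_row_zero (R : ℝ) (hP : OneLinkPoincareSUN 3 (3 / 5) (4 / 5)) (hV : OneLinkVarianceBound 3 (11 / 30) (49 / 20))
    {βW : ℝ} (hβ0 : 0 ≤ βW) (hβ : βW < 5 / 14) : MassGapOnBallZd 4 3 (βW / 9) (2 * 0) 0 R :=
  su3_row R hP hV hβ0 (by linarith) le_rfl (by norm_num) (by norm_num; linarith)

/-- Numbers: the certificate inequalities of the eight rows at one glance, the threshold `5/14` (`(14/5)(5/14) = 1`), `(7/5)² = (4/5)(49/20)`,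
and the radius identity `(2/3)(11/20) = 11/30`. [folklore] -/
theorem su3_rows_numbers :
    (14 / 5 : ℝ) * (5 / 14) = 1 ∧ (7 / 5 : ℝ) ^ 2 = 4 / 5 * (49 / 20) ∧ (2 / 3 : ℝ) * (11 / 20) = 11 / 30 ∧
      (0.8945 : ℝ) ^ 2 ≥ 4 / 5 ∧ (5 / 28 : ℝ) = (5 / 14) / 2 := by
  norm_num

end Summit.Ventures.YMGap.RobustBallSU3

end
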